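import Literature.Analysis.Complex.HydrodynamicExpansion
import Literature.Analysis.Complex.Bieberbach
import HarnessLib

/-!
# The displacement bound `|g(z) - z| ≤ 3 rad` for hydrodynamically normalized univalent maps

G. F. Lawler, *Conformally Invariant Processes in the Plane*, AMS (2005), Cor. 3.44, (3.12):
"for any `A`, `|g_A(z) - z| ≤ 3 rad(A)`, `z ∈ ℍ ∖ A`", proved there from the Brownian-motion
representation of `re g_A` (Prop. 3.43) and the maximum principle. Here is a function-theoretic
proof for the abstract data `Literature.Analysis.Complex.IsHydrodynamicAt g x₀ r`
(`HydrodynamicExpansion`: `g` holomorphic on `{|z - x₀| > r}`, `g(z) - z → 0` at `∞`, …) plus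
INJECTIVITY, through the classical omitted-value estimate for the class `Σ`:

* `IsHydrodynamicAt.norm_sub_le_two_mul_of_forall_ne` — **an omitted value `c` of the univalent
  map `g` on `{|z - x₀| > r}` satisfies `|c - x₀| ≤ 2r`** (P. L. Duren, *Univalent Functions*
  (1983), §2.2: `ζ ↦ 1/(G(1/ζ) - c) ∈ S` has second coefficient `c - b₀`, and Bieberbach's
  `|a₂| ≤ 2`, `Literature.Analysis.Complex.AreaThm.norm_deriv_dslope_le_two`; here
  `b₀ = 0` by the hydrodynamic normalisation);
* `IsHydrodynamicAt.norm_sub_le_of_injOn` — hence, if `g` is injective on a set `Ω ⊇ {|z - x₀| > r}`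
  (for `g_A`: the symmetric slit domain of the hull), then for EVERY `z ∈ Ω`,
  `|g(z) - x₀| ≤ 2 max(r, |z - x₀|)` and **`|g(z) - z| ≤ 3 max(r, |z - x₀|)`**
  (`norm_sub_self_le_of_injOn`; Lawler's (3.12) for `|z - x₀| ≤ r`), and the global bound
  `|g(z) - z| ≤ max(6r, 2a/r)`, `a = hcapAt g x₀`, on `Ω` (`norm_sub_self_le_max`, with
  Prop. 3.46 outside `B(x₀, 2r)`).

These feed the uniform modulus of continuity of `Literature/Analysis/Complex/LengthAreaDiameter.lean`
(hypothesis `‖g z - z‖ ≤ C₀`) and Lawler's Lemma 4.1 (`‖g_s - g_t‖_∞ ≤ 3 rad` of the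
intermediate hull) for Loewner's slit theorem.

## References

* G. F. Lawler, *Conformally Invariant Processes in the Plane* (2005), Cor. 3.44 (3.12)
  [Lawler2005].
* P. L. Duren, *Univalent Functions*, Springer (1983), §2.2 (omitted values of `Σ`).
* Ch. Pommerenke, *Boundary Behaviour of Conformal Maps* (1992), §1.3 (9) [PommerenkeBBCM1992].
-/

noncomputable section

open Set Filter Metric Bornology
open _root_.Complex _root_.Topology

namespace Literature.Analysis.Complex

namespace IsHydrodynamicAt

variable {g : ℂ → ℂ} {x₀ r : ℝ}

/-- The hydrodynamic data outside `B̄(x₀, r)` restrict to the exterior of any larger disc. [folklore] -/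
theorem mono (h : IsHydrodynamicAt g x₀ r) {ρ : ℝ} (hρ : r ≤ ρ) : IsHydrodynamicAt g x₀ ρ where
  pos := h.pos.trans_le hρ
  differentiableOn := h.differentiableOn.mono fun _ hz ↦ hρ.trans_lt hz
  tendsto_sub := h.tendsto_sub
  map_conj z hz := h.map_conj z (hρ.trans_lt hz)
  im_le z hz := h.im_le z (hρ.trans_lt hz)

/-- **Omitted values of a hydrodynamically normalized univalent map lie in `B̄(x₀, 2r)`**
(Duren (1983), §2.2; Bieberbach's `|a₂| ≤ 2` applied to `ζ ↦ ζ/(r ζ (g(x₀ + r/ζ·…)))`): if `g`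
is injective on `{|z - x₀| > r}` and `g(z) ≠ c` there, then `|c - x₀| ≤ 2r`.
[cite: PommerenkeBBCM1992, §1.3 eq. (9)] -/
theorem norm_sub_le_two_mul_of_forall_ne (h : IsHydrodynamicAt g x₀ r)
    (hinj : InjOn g {z : ℂ | r < ‖z - x₀‖}) {c : ℂ} (hc : ∀ z : ℂ, r < ‖z - x₀‖ → g z ≠ c) :
    ‖c - x₀‖ ≤ 2 * r := by
  have hr := h.pos
  have hrC : (r : ℂ) ≠ 0 := by exact_mod_cast hr.ne'
  set B : Set ℂ := ball (0 : ℂ) r⁻¹ with hB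
  have hB0 : (0 : ℂ) ∈ B := mem_ball_self (inv_pos.2 hr)
  have hBo : IsOpen B := isOpen_ball
  set f : ℂ → ℂ := invertAt g x₀ with hf
  have hfd : DifferentiableOn ℂ f B := h.differentiableOn_invertAt
  -- the denominator `D(w) = 1 + (x₀ - c) w + w f(w) = w (g(x₀ + 1/w) - c)`
  set D : ℂ → ℂ := fun w ↦ 1 + ((x₀ : ℂ) - c) * w + w * f w with hD
  have hDd : DifferentiableOn ℂ D B := by
    refine ((differentiableOn_const _).add ((differentiableOn_const _).mul differentiableOn_id)).add
      (differentiableOn_id.mul hfd)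
  have hD0 : D 0 = 1 := by simp [hD]
  have hDeq : ∀ w ∈ B, w ≠ 0 → D w = w * (g (x₀ + w⁻¹) - c) := fun w _ hw0 ↦ by
    simp only [hD, hf, invertAt_of_ne hw0]
    field_simp
    ring
  have hDne : ∀ w ∈ B, D w ≠ 0 := fun w hw ↦ by
    rcases eq_or_ne w 0 with rfl | hw0
    · rw [hD0]; exact one_ne_zero
    · rw [hDeq w hw hw0]
      exact mul_ne_zero hw0 (sub_ne_zero.2 (hc _ (h.lt_norm_of_mem_ball hw hw0)))
  have hDderiv : HasDerivAt D ((x₀ : ℂ) - c) 0 := by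
    have h1 : HasDerivAt (fun w : ℂ ↦ 1 + ((x₀ : ℂ) - c) * w) ((x₀ : ℂ) - c) 0 := by
      simpa using ((hasDerivAt_id (0 : ℂ)).const_mul ((x₀ : ℂ) - c)).const_add 1
    have hf0 : HasDerivAt f (deriv f 0) 0 := (hfd.differentiableAt (hBo.mem_nhds hB0)).hasDerivAt
    have h2 : HasDerivAt (fun w : ℂ ↦ w * f w) (1 * f 0 + 0 * deriv f 0) 0 :=
      (hasDerivAt_id (0 : ℂ)).mul hf0
    have h3 := h1.add h2
    simp only [hf, invertAt_zero, mul_zero, zero_mul, add_zero] at h3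
    exact h3
  -- `q = 1/D`, `q(0) = 1`, `q'(0) = c - x₀`
  set q : ℂ → ℂ := fun w ↦ (D w)⁻¹ with hq
  have hqd : DifferentiableOn ℂ q B := hDd.inv hDne
  have hq0 : q 0 = 1 := by simp [hq, hD0]
  have hqne : ∀ w ∈ B, q w ≠ 0 := fun w hw ↦ inv_ne_zero (hDne w hw)
  have hqderiv : HasDerivAt q (c - (x₀ : ℂ)) 0 := by
    have := hDderiv.inv (by rw [hD0]; exact one_ne_zero)
    rw [hD0] at this
    exact this.congr_deriv (by ring)
  -- the map of class `S`: `F₁(ζ) = ζ q(ζ/r)` on the unit disc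
  have hscale : ∀ ζ ∈ ball (0 : ℂ) 1, ζ * (r : ℂ)⁻¹ ∈ B := fun ζ hζ ↦ by
    rw [hB, mem_ball_zero_iff, norm_mul, norm_inv, Complex.norm_real, Real.norm_of_nonneg hr.le]
    rw [mem_ball_zero_iff] at hζ
    exact mul_lt_of_lt_one_left (inv_pos.2 hr) hζ
  set F₁ : ℂ → ℂ := fun ζ ↦ ζ * q (ζ * (r : ℂ)⁻¹) with hF₁
  have hsc : DifferentiableOn ℂ (fun ζ : ℂ ↦ q (ζ * (r : ℂ)⁻¹)) (ball 0 1) :=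
    hqd.comp (differentiableOn_id.mul (differentiableOn_const _)) hscale
  have hF₁d : DifferentiableOn ℂ F₁ (ball 0 1) := differentiableOn_id.mul hsc
  have hF₁0 : F₁ 0 = 0 := by simp [hF₁]
  have hscd : HasDerivAt (fun ζ : ℂ ↦ q (ζ * (r : ℂ)⁻¹)) ((c - (x₀ : ℂ)) * (r : ℂ)⁻¹) 0 := by
    have h1 : HasDerivAt (fun ζ : ℂ ↦ ζ * (r : ℂ)⁻¹) (r : ℂ)⁻¹ 0 := by
      simpa using (hasDerivAt_id (0 : ℂ)).mul_const (r : ℂ)⁻¹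
    have h2 : HasDerivAt q (c - (x₀ : ℂ)) (0 * (r : ℂ)⁻¹) := by rwa [zero_mul]
    have h3 := HasDerivAt.comp (0 : ℂ) h2 h1
    exact h3
  have hF₁deriv : HasDerivAt F₁ 1 0 := by
    have := (hasDerivAt_id' (0 : ℂ)).mul hscd
    refine this.congr_deriv ?_
    simp [hq0]
  have hF₁1 : deriv F₁ 0 = 1 := hF₁deriv.deriv
  -- injectivity of `F₁`
  have hF₁inj : InjOn F₁ (ball 0 1) := by
    intro ζ₁ hζ₁ ζ₂ hζ₂ heq
    simp only [hF₁] at heq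
    set w₁ := ζ₁ * (r : ℂ)⁻¹ with hw₁
    set w₂ := ζ₂ * (r : ℂ)⁻¹ with hw₂
    have hw₁B := hscale ζ₁ hζ₁
    have hw₂B := hscale ζ₂ hζ₂
    have hζw₁ : ζ₁ = r * w₁ := by rw [hw₁]; field_simp
    have hζw₂ : ζ₂ = r * w₂ := by rw [hw₂]; field_simp
    rcases eq_or_ne ζ₁ 0 with h1 | h1
    · rw [h1, zero_mul] at heq
      rcases mul_eq_zero.1 heq.symm with h2 | h2
      · rw [h1, h2]
      · exact absurd h2 (hqne _ hw₂B)
    rcases eq_or_ne ζ₂ 0 with h2 | h2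
    · rw [h2, zero_mul] at heq
      rcases mul_eq_zero.1 heq with h3 | h3
      · exact absurd h3 h1
      · exact absurd h3 (hqne _ hw₁B)
    have hw₁0 : w₁ ≠ 0 := mul_ne_zero h1 (inv_ne_zero hrC)
    have hw₂0 : w₂ ≠ 0 := mul_ne_zero h2 (inv_ne_zero hrC)
    -- `ζ q(w) = r / (g(x₀ + 1/w) - c)`
    have hval : ∀ {ζ w : ℂ}, ζ = r * w → w ∈ B → w ≠ 0 →
        ζ * q w = r * (g (x₀ + w⁻¹) - c)⁻¹ := by
      intro ζ w hζw hwB hw0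
      rw [hq]; dsimp only
      rw [hDeq w hwB hw0, hζw, mul_inv]
      field_simp
    rw [hval hζw₁ hw₁B hw₁0, hval hζw₂ hw₂B hw₂0] at heq
    have hg₁ : r < ‖(x₀ : ℂ) + w₁⁻¹ - x₀‖ := h.lt_norm_of_mem_ball hw₁B hw₁0
    have hg₂ : r < ‖(x₀ : ℂ) + w₂⁻¹ - x₀‖ := h.lt_norm_of_mem_ball hw₂B hw₂0
    have heq' : g (x₀ + w₁⁻¹) = g (x₀ + w₂⁻¹) := by
      have := mul_left_cancel₀ hrC heq
      rw [inv_inj] at this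
      exact sub_left_injective this
    have := hinj hg₁ hg₂ heq'
    rw [add_right_inj, inv_inj] at this
    rw [hζw₁, hζw₂, this]
  -- `dslope F₁ 0 = q(·/r)` and Bieberbach
  have hds : dslope F₁ 0 = fun ζ ↦ q (ζ * (r : ℂ)⁻¹) := by
    funext ζ
    rcases eq_or_ne ζ 0 with rfl | hζ
    · rw [dslope_same, hF₁1, zero_mul, hq0]
    · rw [dslope_of_ne _ hζ, slope_def_field, hF₁0, sub_zero, sub_zero]
      simp only [hF₁]
      field_simp
  have hB2 := AreaThm.norm_deriv_dslope_le_two hF₁d hF₁inj hF₁0 hF₁1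
  rw [hds, hscd.deriv, norm_mul, norm_inv, Complex.norm_real, Real.norm_of_nonneg hr.le] at hB2
  rwa [← div_eq_mul_inv, div_le_iff₀ hr] at hB2

/-- **`|g(z) - x₀| ≤ 2 max(r, |z - x₀|)` on any set of injectivity `Ω ⊇ {|z - x₀| > r}`**: the
value `g(z)` is omitted on `{|z' - x₀| > ρ}` for every `ρ > max(r, |z - x₀|)`. [folklore] -/
theorem norm_sub_le_of_injOn (h : IsHydrodynamicAt g x₀ r) {Ω : Set ℂ}
    (hΩ : {z : ℂ | r < ‖z - x₀‖} ⊆ Ω) (hinj : InjOn g Ω) {z : ℂ} (hz : z ∈ Ω) :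
    ‖g z - x₀‖ ≤ 2 * max r ‖z - x₀‖ := by
  refine le_of_forall_gt_imp_ge_of_dense fun m hm ↦ ?_
  set ρ : ℝ := m / 2 with hρ
  have hρmax : max r ‖z - x₀‖ < ρ := by rw [hρ]; linarith
  have hrρ : r < ρ := (le_max_left _ _).trans_lt hρmax
  have hzρ : ‖z - x₀‖ < ρ := (le_max_right _ _).trans_lt hρmax
  have hsub : {z' : ℂ | ρ < ‖z' - x₀‖} ⊆ Ω := fun z' hz' ↦ hΩ (hrρ.trans hz')
  have h1 := (h.mono hrρ.le).norm_sub_le_two_mul_of_forall_ne (hinj.mono hsub) (c := g z)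
    fun z' hz' heq ↦ by
      have := hinj (hsub hz') hz heq
      rw [this] at hz'
      exact absurd (hzρ.trans hz') (lt_irrefl _)
  rw [hρ] at h1
  linarith

/-- **Lawler's (3.12), abstract form: `|g(z) - z| ≤ 3 max(r, |z - x₀|)`** on any set of
injectivity `Ω ⊇ {|z - x₀| > r}` (in particular `≤ 3r` on `Ω ∩ B̄(x₀, r)`).
[cite: Lawler2005, Cor. 3.44 (3.12)] -/
theorem norm_sub_self_le_of_injOn (h : IsHydrodynamicAt g x₀ r) {Ω : Set ℂ}
    (hΩ : {z : ℂ | r < ‖z - x₀‖} ⊆ Ω) (hinj : InjOn g Ω) {z : ℂ} (hz : z ∈ Ω) :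
    ‖g z - z‖ ≤ 3 * max r ‖z - x₀‖ := by
  have h1 := h.norm_sub_le_of_injOn hΩ hinj hz
  calc ‖g z - z‖ = ‖(g z - x₀) - (z - x₀)‖ := by ring_nf
    _ ≤ ‖g z - x₀‖ + ‖z - x₀‖ := norm_sub_le _ _
    _ ≤ 2 * max r ‖z - x₀‖ + max r ‖z - x₀‖ := add_le_add h1 (le_max_right _ _)
    _ = 3 * max r ‖z - x₀‖ := by ring

/-- **Global displacement bound**: `|g(z) - z| ≤ max(6r, 2a/r)` on `Ω`, `a = hcapAt g x₀ > 0`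
(the previous bound inside `B̄(x₀, 2r)`, Prop. 3.46 — `|g(z) - z| ≤ 4a/|z - x₀|`,
`IsHydrodynamicAt.norm_sub_self_le` — outside). [cite: Lawler2005, Cor. 3.44 (3.12) and Prop. 3.46] -/
theorem norm_sub_self_le_max (h : IsHydrodynamicAt g x₀ r) (ha : 0 < hcapAt g x₀) {Ω : Set ℂ}
    (hΩ : {z : ℂ | r < ‖z - x₀‖} ⊆ Ω) (hinj : InjOn g Ω) {z : ℂ} (hz : z ∈ Ω) :
    ‖g z - z‖ ≤ max (6 * r) (2 * hcapAt g x₀ / r) := by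
  have hr := h.pos
  rcases le_or_gt (2 * r) ‖z - x₀‖ with hfar | hnear
  · refine (h.norm_sub_self_le ha hfar).trans ((le_max_right _ _).trans' ?_)
    rw [div_le_div_iff₀ (by linarith) hr]
    nlinarith [ha.le]
  · refine (h.norm_sub_self_le_of_injOn hΩ hinj hz).trans ((le_max_left _ _).trans' ?_)
    have : max r ‖z - x₀‖ ≤ 2 * r := max_le (by linarith) hnear.le
    linarith

end IsHydrodynamicAt

end Literature.Analysis.Complex
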